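import Mathlib.FieldTheory.Galois.Infinite
import Mathlib.FieldTheory.AbsoluteGaloisGroup
import Mathlib.Topology.Algebra.ContinuousMonoidHom
import Mathlib.NumberTheory.NumberField.InfinitePlace.Basic
import Mathlib.GroupTheory.Torsion
import Literature.NumberTheory.GaloisRepresentations.AbsGaloisGroup
import Literature.NumberTheory.GaloisRepresentations.GaloisRep
import HarnessLib

-- provenance: harness21/H21/H21/Prelude/EllArithM/ZpExtension.lean @ ed43db4 (interim HEAD d8f2665); M5 mechanical rewrite
/-!
# `ℤ_p`-extensions of a field (trunk EllArithM, item C10 = `G16:ZpExtension`)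

Notion `cyclotomic_zp_extension`.  A `ℤ_p`-extension of a field `K` is a Galois extension
`K_∞/K` (inside a fixed algebraic closure `K̄`) with `Gal(K_∞/K) ≃ ℤ_p` as topological groups.
Following the outline (OUTLINE C10) we take the *choice-free* avatar: a `ℤ_p`-extension is a
continuous surjection `κ : Γ_K →ₜ* ℤ_p` from the absolute Galois group
`Γ_K = Field.absoluteGaloisGroup K`; the field `K_∞` is the fixed field of `ker κ` and the `n`-th
layer `K_n` is the fixed field of `κ⁻¹(p^n ℤ_p)`.  Two such `κ` define the same tower iff they
differ by a unit of `ℤ_p` (`unitTwist`, `IsCyclotomic.exists_eq_unitTwist`).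

## Main definitions (namespace `Literature`)

* `Literature.ZpExtension K p`: continuous surjections `Γ_K →ₜ* Multiplicative ℤ_[p]`
  (with `FunLike`, `MonoidHomClass`, `ContinuousMapClass` instances).
* `ZpExtension.kerSubgroup`, `ZpExtension.top` (`K_∞`), `ZpExtension.layerSubgroup n`
  (`κ⁻¹(p^n ℤ_p)`), `ZpExtension.layer n` (`K_n`), `ZpExtension.IsTopGenerator`
  (`κ γ = 1 ∈ ℤ_p`, i.e. `γ` maps to a topological generator of `Gal(K_∞/K)`),
  `ZpExtension.unitTwist u` (post-composition with multiplication by `u ∈ ℤ_pˣ`).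
* `ZpExtension.IsCyclotomic κ`: `ker κ = χ_p⁻¹(μ(ℤ_p))` where
  `χ_p = Literature.GaloisRep.cyclotomicCharacter K p : Γ_K →ₜ* ℤ_[p]ˣ` is the accepted cyclotomic
  character of `Literature.Prelude.GalRep.GaloisRep` (no local duplicate) and `μ(ℤ_p)` is
  `CommGroup.torsion ℤ_[p]ˣ`; i.e. `K_∞ = K_∞^{cyc}`, the unique `ℤ_p`-extension inside
  `K(μ_{p^∞})`.
* `ZpExtension.IsAnticyclotomic κ` (`[NumberField K]`, meaningful for imaginary quadratic `K`):
  every lift `ρ ∈ Γ_ℚ ∖ Γ_K` of the non-trivial automorphism of `K/ℚ` acts on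
  `Gal(K_∞/K) ≃ ℤ_p` by `-1`, phrased with `Literature.absGaloisRestrict ℚ K : Γ_K →ₜ* Γ_ℚ`.

## Main statements

Proved API: `layerSubgroup_normal`, `kerSubgroup_le_layerSubgroup`, `layerSubgroup_antitone`,
`isClosed_kerSubgroup`, `isOpen_layerSubgroup`, `layerSubgroup_zero`, `layer_zero`, `layer_mono`,
`layer_le_top`, `kerSubgroup_unitTwist`, `layerSubgroup_unitTwist`, `top_unitTwist`,
`layer_unitTwist`, `IsCyclotomic.exists_eq_unitTwist_of`.

Named facts (`def … : Prop`, D-0014): `finiteDimensional_layer`, `finrank_layer`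
(`[K_n : K] = p^n`), `isGalois_layer`, `iSup_layer_eq_top`, `exists_isCyclotomic`,
`IsCyclotomic.exists_eq_unitTwist`, `exists_eq_unitTwist_of_kerSubgroup_eq`,
`exists_isAnticyclotomic`.
Discharged (sorry-free, end of file): `finrank_layer_holds`, `finiteDimensional_layer_holds`,
`isGalois_layer_holds`, via the Krull–Galois correspondence (`fixingSubgroup_layer`,
`index_layerSubgroup`, `index_toSubgroup_span_pow`).

Remark (number of independent `ℤ_p`-extensions; docstring only).  For a number field `K` with
`r₂` complex places the compositum of all `ℤ_p`-extensions has Galois group `ℤ_p^{r₂ + 1 + δ}`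
with `δ ≥ 0` the Leopoldt defect (`δ = 0` is Leopoldt's conjecture, known for `K/ℚ` abelian);
Washington, *Introduction to Cyclotomic Fields*, Thm. 13.4.  We do not state this.

## Mathlib declarations used

`Field.absoluteGaloisGroup`, `ContinuousMonoidHom`, `PadicInt`, `Multiplicative`,
`IntermediateField.fixedField`, `Subgroup.comap`, `Ideal.span`, `AddSubgroup.toSubgroup`,
`CommGroup.torsion`,
`NumberField.InfinitePlace.IsComplex`.  Mathlib has no notion of `ℤ_p`-extension (grep
`Zp.*[Ee]xtension`, `Iwasawa` in `Mathlib/`: nothing).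

## Design notes

* `Field.absoluteGaloisGroup K` is *definitionally* `AlgebraicClosure K ≃ₐ[K] AlgebraicClosure K`
  but the `def` is not reducible, so subgroups of `Γ_K` are transported to subgroups of
  `K̄ ≃ₐ[K] K̄` along the identity `MulEquiv` `Field.absoluteGaloisGroup.toAlgEquiv K` (accepted
  G09) before taking `IntermediateField.fixedField`.
* Degree and Galois statements about the finite layers (`layer_zero`, `finiteDimensional_layer`,
  `finrank_layer`, `isGalois_layer`) assume `[PerfectField K]`: for an imperfect field the fixed
  field of all of `Aut(K̄/K)` is the perfect closure of `K`, which is infinite-dimensional over `K`,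
  so these statements would be false (junk `finrank = 0`).  All number-field applications are in
  characteristic `0`.
* `noncomputable section`, no `[DecidableEq K]` (G06 §0); nothing here needs
  `open scoped Classical`, so it is omitted; `K : Type u`.

Sources: K. Iwasawa, *On Γ-extensions of algebraic number fields*, Bull. AMS 65 (1959);
K. Iwasawa, *On ℤ_ℓ-extensions of algebraic number fields*, Ann. of Math. 98 (1973);
L. Washington, *Introduction to Cyclotomic Fields* (2nd ed. 1997), Ch. 13, esp. §13.1–13.2;
R. Greenberg, *Iwasawa theory for elliptic curves*, LNM 1716 (1999), §1.
-/

noncomputable section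

open scoped Topology

universe u

namespace Literature.NumberTheory.EllipticCurves

open Field

variable (K : Type u) [Field K] (p : ℕ) [Fact p.Prime]

/-- A **`ℤ_p`-extension** of the field `K`, in choice-free form: a continuous surjective group
homomorphism `κ : Γ_K →ₜ* ℤ_p` (written multiplicatively).  The corresponding tower is
`K_∞ = K̄^{ker κ}`, with `Gal(K_∞/K) ≃ ℤ_p`; conversely every Galois extension `K_∞/K` with
group `≃ ℤ_p` arises this way, from a `κ` unique up to `ℤ_pˣ` (`unitTwist`).
Ref: Washington, *Introduction to Cyclotomic Fields*, §13.1; Iwasawa (1973), §1. [cite: Iwasawa1973] -/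
structure ZpExtension where
  /-- The defining continuous homomorphism `Γ_K →ₜ* ℤ_p`. -/
  toContinuousMonoidHom : absoluteGaloisGroup K →ₜ* Multiplicative ℤ_[p]
  /-- The homomorphism is surjective (so `Gal(K_∞/K) ≃ ℤ_p`). -/
  surjective : Function.Surjective toContinuousMonoidHom

namespace ZpExtension

variable {K p}

/-- Two `ℤ_p`-extensions (as maps `Γ_K →ₜ* ℤ_p`) are equal iff their defining homomorphisms
are.  Ref: Washington, *Introduction to Cyclotomic Fields*, §13.1. [folklore] -/
lemma toContinuousMonoidHom_injective :
    Function.Injective (toContinuousMonoidHom : ZpExtension K p → _) := by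
  rintro ⟨f, _⟩ ⟨g, _⟩ h
  congr

/-- `κ : ZpExtension K p` coerces to the function `Γ_K → ℤ_p`.
Ref: Washington, *Introduction to Cyclotomic Fields*, §13.1. [folklore] -/
instance instFunLike :
    FunLike (ZpExtension K p) (absoluteGaloisGroup K) (Multiplicative ℤ_[p]) where
  coe κ := κ.toContinuousMonoidHom
  coe_injective _ _ h := toContinuousMonoidHom_injective (DFunLike.coe_injective h)

/-- `κ : ZpExtension K p` is a monoid homomorphism.
Ref: Washington, *Introduction to Cyclotomic Fields*, §13.1. [folklore] -/
instance instMonoidHomClass :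
    MonoidHomClass (ZpExtension K p) (absoluteGaloisGroup K) (Multiplicative ℤ_[p]) where
  map_mul κ := map_mul κ.toContinuousMonoidHom
  map_one κ := map_one κ.toContinuousMonoidHom

/-- `κ : ZpExtension K p` is continuous.
Ref: Washington, *Introduction to Cyclotomic Fields*, §13.1. [folklore] -/
instance instContinuousMapClass :
    ContinuousMapClass (ZpExtension K p) (absoluteGaloisGroup K) (Multiplicative ℤ_[p]) where
  map_continuous κ := κ.toContinuousMonoidHom.continuous

/-- Unfolding lemma: the coercion of `κ` is that of `κ.toContinuousMonoidHom`. [folklore] -/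
@[simp] lemma coe_toContinuousMonoidHom (κ : ZpExtension K p) :
    ⇑κ.toContinuousMonoidHom = κ := rfl

/-- The kernel `ker κ = Gal(K̄/K_∞) ≤ Γ_K` of a `ℤ_p`-extension.
Ref: Washington, *Introduction to Cyclotomic Fields*, §13.1. [folklore] -/
def kerSubgroup (κ : ZpExtension K p) : Subgroup (absoluteGaloisGroup K) :=
  κ.toContinuousMonoidHom.toMonoidHom.ker

/-- Membership in `kerSubgroup`. [folklore] -/
@[simp] lemma mem_kerSubgroup {κ : ZpExtension K p} {σ : absoluteGaloisGroup K} :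
    σ ∈ κ.kerSubgroup ↔ κ σ = 1 := Iff.rfl

/-- The top field `K_∞ ⊆ K̄` of the `ℤ_p`-extension: the fixed field of `ker κ` (transported to a
subgroup of `K̄ ≃ₐ[K] K̄` along the identity `Field.absoluteGaloisGroup.toAlgEquiv`).
Ref: Washington, *Introduction to Cyclotomic Fields*, §13.1. [folklore] -/
def top (κ : ZpExtension K p) : IntermediateField K (AlgebraicClosure K) :=
  IntermediateField.fixedField
    (κ.kerSubgroup.map (absoluteGaloisGroup.toAlgEquiv K).toMonoidHom)

/-- The subgroup `κ⁻¹(p^n ℤ_p) = Gal(K̄/K_n) ≤ Γ_K` cutting out the `n`-th layer; here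
`p^n ℤ_p = Ideal.span {p^n}` (an open subgroup of index `p^n`, cf. `PadicInt.ker_toZModPow`).
Ref: Washington, *Introduction to Cyclotomic Fields*, §13.1. [folklore] -/
def layerSubgroup (κ : ZpExtension K p) (n : ℕ) : Subgroup (absoluteGaloisGroup K) :=
  (AddSubgroup.toSubgroup (Ideal.span {(p : ℤ_[p]) ^ n}).toAddSubgroup).comap
    κ.toContinuousMonoidHom.toMonoidHom

/-- Membership in `layerSubgroup`: `σ ∈ κ⁻¹(p^n ℤ_p) ↔ p^n ∣ κ σ` in `ℤ_p`. [folklore] -/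
lemma mem_layerSubgroup {κ : ZpExtension K p} {n : ℕ} {σ : absoluteGaloisGroup K} :
    σ ∈ κ.layerSubgroup n ↔ (p : ℤ_[p]) ^ n ∣ (κ σ).toAdd := by
  rw [layerSubgroup, Subgroup.mem_comap, Multiplicative.mem_toSubgroup, Submodule.mem_toAddSubgroup,
    Ideal.mem_span_singleton]
  rfl

/-- The `n`-th layer `K_n ⊆ K̄` of the `ℤ_p`-extension: the fixed field of `κ⁻¹(p^n ℤ_p)`, the
unique subextension of `K_∞/K` of degree `p^n` (`finrank_layer`).
Ref: Washington, *Introduction to Cyclotomic Fields*, §13.1. [folklore] -/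
def layer (κ : ZpExtension K p) (n : ℕ) : IntermediateField K (AlgebraicClosure K) :=
  IntermediateField.fixedField
    ((κ.layerSubgroup n).map (absoluteGaloisGroup.toAlgEquiv K).toMonoidHom)

/-- `γ ∈ Γ_K` is a **topological generator** for `κ`: `κ γ = 1 ∈ ℤ_p`, so the image of `γ`
topologically generates `Gal(K_∞/K) ≃ ℤ_p` (the `γ` with `T = γ - 1` of Iwasawa theory).
Ref: Washington, *Introduction to Cyclotomic Fields*, §13.2. [folklore] -/
def IsTopGenerator (κ : ZpExtension K p) (γ : absoluteGaloisGroup K) : Prop :=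
  κ γ = Multiplicative.ofAdd 1

/-- Multiplication by a unit `u ∈ ℤ_pˣ` as a continuous automorphism of (multiplicative) `ℤ_p`.
Auxiliary for `unitTwist`.  Ref: Washington, *Introduction to Cyclotomic Fields*, §13.1. [folklore] -/
def mulUnit (u : ℤ_[p]ˣ) : Multiplicative ℤ_[p] →ₜ* Multiplicative ℤ_[p] where
  toMonoidHom := (AddMonoidHom.mulLeft (u : ℤ_[p])).toMultiplicative
  continuous_toFun := continuous_const_mul (u : ℤ_[p])

/-- Unfolding lemma for `mulUnit`. [folklore] -/
@[simp] lemma mulUnit_apply (u : ℤ_[p]ˣ) (x : Multiplicative ℤ_[p]) :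
    mulUnit u x = Multiplicative.ofAdd ((u : ℤ_[p]) * x.toAdd) := rfl

/-- The **unit twist** `u • κ` of a `ℤ_p`-extension by `u ∈ ℤ_pˣ`: post-compose with
multiplication by `u`.  It has the same kernel and layers, and every `κ'` with the same kernel is
of this form (`IsCyclotomic.exists_eq_unitTwist`).
Ref: Washington, *Introduction to Cyclotomic Fields*, §13.1. [folklore] -/
def unitTwist (κ : ZpExtension K p) (u : ℤ_[p]ˣ) : ZpExtension K p where
  toContinuousMonoidHom := (mulUnit u).comp κ.toContinuousMonoidHom
  surjective := by
    intro y
    obtain ⟨σ, hσ⟩ := κ.surjective (Multiplicative.ofAdd ((↑u⁻¹ : ℤ_[p]) * y.toAdd))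
    refine ⟨σ, ?_⟩
    change mulUnit u (κ.toContinuousMonoidHom σ) = y
    rw [hσ, mulUnit_apply, toAdd_ofAdd, ← mul_assoc, Units.mul_inv, one_mul, ofAdd_toAdd]

/-- Unfolding lemma for `unitTwist`. [folklore] -/
@[simp] lemma unitTwist_apply (κ : ZpExtension K p) (u : ℤ_[p]ˣ) (σ : absoluteGaloisGroup K) :
    κ.unitTwist u σ = Multiplicative.ofAdd ((u : ℤ_[p]) * (κ σ).toAdd) := rfl

/-- `κ` is the **cyclotomic** `ℤ_p`-extension: `ker κ = χ_p⁻¹(μ(ℤ_p))`, where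
`χ_p : Γ_K →ₜ* ℤ_pˣ` is the `p`-adic cyclotomic character (`Literature.NumberTheory.GaloisRepresentations.GaloisRep.cyclotomicCharacter`)
and `μ(ℤ_p) = (ℤ_pˣ)_{tors}`; equivalently `K_∞ = K_∞^{cyc}` is the fixed field of
`χ_p⁻¹(μ(ℤ_p))`, the unique `ℤ_p`-extension of `K` inside `K(μ_{p^∞})`.
Ref: Washington, *Introduction to Cyclotomic Fields*, §13.1 (p. 264); Greenberg, LNM 1716 (1999), §1.
[cite: Washington1997, §13.1] [cite: GreenbergLNM1716, §1] -/
def IsCyclotomic (κ : ZpExtension K p) : Prop :=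
  κ.kerSubgroup =
    (CommGroup.torsion ℤ_[p]ˣ).comap (GaloisRepresentations.GaloisRep.cyclotomicCharacter K p).toMonoidHom

section NumberField

variable [NumberField K]

/-- `κ` is an **anticyclotomic** `ℤ_p`-extension of the number field `K` (meaningful when `K` is
imaginary quadratic, `[K : ℚ] = 2`): every `ρ ∈ Γ_ℚ` *not* in the image of `Γ_K → Γ_ℚ`
(`Literature.absGaloisRestrict ℚ K`, i.e. `ρ` restricts to the non-trivial automorphism of `K`) acts on
`Gal(K_∞/K) ≃ ℤ_p` by inversion: if `τ ↦ ρ σ ρ⁻¹` then `κ τ = (κ σ)⁻¹`.  Equivalently `K_∞/ℚ` is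
Galois with `Gal(K_∞/ℚ) ≃ ℤ_p ⋊ (ℤ/2)` generalised dihedral.
Vacuity: for `K = ℚ` (more generally whenever `Γ_K → Γ_ℚ` is surjective) the range is everything
and the predicate holds vacuously; for `[K : ℚ] > 2` or `K` real quadratic it is not the intended
notion (for real quadratic `K` it is unsatisfiable).  Use only under the hypotheses of
`exists_isAnticyclotomic`.
Ref: Greenberg, *Iwasawa theory for elliptic curves* (1999), §1; Washington, §13.1. [folklore] -/
def IsAnticyclotomic (κ : ZpExtension K p) : Prop :=
  ∀ (σ τ : absoluteGaloisGroup K) (ρ : absoluteGaloisGroup ℚ),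
    ρ ∉ Set.range (GaloisRepresentations.absGaloisRestrict ℚ K) →
      GaloisRepresentations.absGaloisRestrict ℚ K τ = ρ * GaloisRepresentations.absGaloisRestrict ℚ K σ * ρ⁻¹ → κ τ = (κ σ)⁻¹

end NumberField

/-! ### API -/

variable (κ : ZpExtension K p)

/-- `κ⁻¹(p^n ℤ_p)` is a normal subgroup of `Γ_K` (preimage of a subgroup of an abelian group).
Ref: Washington, *Introduction to Cyclotomic Fields*, §13.1. [folklore] -/
instance layerSubgroup_normal (n : ℕ) : (κ.layerSubgroup n).Normal :=
  Subgroup.normal_comap _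

/-- `ker κ ≤ κ⁻¹(p^n ℤ_p)`, i.e. `K_n ⊆ K_∞`.
Ref: Washington, *Introduction to Cyclotomic Fields*, §13.1. [folklore] -/
lemma kerSubgroup_le_layerSubgroup (n : ℕ) : κ.kerSubgroup ≤ κ.layerSubgroup n := by
  intro σ hσ
  rw [mem_layerSubgroup, mem_kerSubgroup.mp hσ, toAdd_one]
  exact dvd_zero _

/-- `κ⁻¹(p^{n+1} ℤ_p) ≤ κ⁻¹(p^n ℤ_p)`.
Ref: Washington, *Introduction to Cyclotomic Fields*, §13.1. [folklore] -/
lemma layerSubgroup_antitone : Antitone κ.layerSubgroup := by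
  intro n m hnm σ hσ
  rw [mem_layerSubgroup] at hσ ⊢
  exact (pow_dvd_pow _ hnm).trans hσ

/-- `ker κ` is closed in `Γ_K` (kernel of a continuous homomorphism to a Hausdorff group).
Ref: Washington, *Introduction to Cyclotomic Fields*, §13.1. [folklore] -/
lemma isClosed_kerSubgroup : IsClosed (κ.kerSubgroup : Set (absoluteGaloisGroup K)) := by
  have : IsClosed ({1} : Set (Multiplicative ℤ_[p])) :=
    isClosed_singleton (X := ℤ_[p]) (x := (0 : ℤ_[p]))
  exact this.preimage (map_continuous κ)

/-- `κ⁻¹(p^n ℤ_p)` is open (and closed) in `Γ_K`, being the preimage of the open subgroup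
`p^n ℤ_p = {x : ‖x‖ ≤ p⁻ⁿ}` (a closed ball of positive radius in an ultrametric space, hence open,
`PadicInt.norm_le_pow_iff_mem_span_pow`, `IsUltrametricDist.isOpen_closedBall`).
Ref: Washington, *Introduction to Cyclotomic Fields*, §13.1. [folklore] -/
lemma isOpen_layerSubgroup (n : ℕ) :
    IsOpen (κ.layerSubgroup n : Set (absoluteGaloisGroup K)) := by
  have hball : ((Ideal.span {(p : ℤ_[p]) ^ n} : Ideal ℤ_[p]) : Set ℤ_[p]) =
      Metric.closedBall (0 : ℤ_[p]) ((p : ℝ) ^ (-n : ℤ)) := by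
    ext x
    rw [SetLike.mem_coe, Metric.mem_closedBall, dist_zero_right,
      PadicInt.norm_le_pow_iff_mem_span_pow]
  have hopen : IsOpen ((Ideal.span {(p : ℤ_[p]) ^ n} : Ideal ℤ_[p]) : Set ℤ_[p]) := by
    rw [hball]
    refine IsUltrametricDist.isOpen_closedBall _ (zpow_ne_zero _ ?_)
    exact_mod_cast (Fact.out : p.Prime).ne_zero
  exact hopen.preimage (map_continuous κ)

/-- The layers increase: `K_n ⊆ K_m` for `n ≤ m`.
Ref: Washington, *Introduction to Cyclotomic Fields*, §13.1. [folklore] -/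
lemma layer_mono : Monotone κ.layer :=
  fun _ _ hnm => IntermediateField.fixedField_le (Subgroup.map_mono (κ.layerSubgroup_antitone hnm))

/-- Each layer is contained in the top field: `K_n ⊆ K_∞`.
Ref: Washington, *Introduction to Cyclotomic Fields*, §13.1. [folklore] -/
lemma layer_le_top (n : ℕ) : κ.layer n ≤ κ.top :=
  IntermediateField.fixedField_le (Subgroup.map_mono (κ.kerSubgroup_le_layerSubgroup n))

/-- `K_0 = K` (for perfect `K`, so that `K̄/K` is Galois; see the module docstring).
`κ⁻¹(p^0 ℤ_p) = κ⁻¹(ℤ_p) = Γ_K`, and the fixed field of all of `Gal(K̄/K)` is `K` because `K̄/K`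
is Galois for perfect `K` (`InfiniteGalois.fixedField_bot`).
Ref: Washington, *Introduction to Cyclotomic Fields*, §13.1. [folklore] -/
lemma layerSubgroup_zero : κ.layerSubgroup 0 = ⊤ := by
  ext σ
  simp only [mem_layerSubgroup, pow_zero, one_dvd, Subgroup.mem_top]

/-- `K_0 = K` (for perfect `K`, so that `K̄/K` is Galois; see the module docstring).
Ref: Washington, *Introduction to Cyclotomic Fields*, §13.1. [folklore] -/
lemma layer_zero [PerfectField K] : κ.layer 0 = ⊥ := by
  rw [layer, layerSubgroup_zero, ← MonoidHom.range_eq_map,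
    MonoidHom.range_eq_top_of_surjective _ (absoluteGaloisGroup.toAlgEquiv K).surjective]
  exact InfiniteGalois.fixedField_bot

/-- Each layer `K_n/K` is a finite extension (perfect `K`): `κ⁻¹(p^n ℤ_p)` is an open, hence
finite-index, closed subgroup of `Γ_K`, and the Krull–Galois correspondence.
Ref: Washington, *Introduction to Cyclotomic Fields*, §13.1 (the tower `K = K_0 ⊂ K_1 ⊂ ⋯ ⊂ K_∞`,
`Gal(K_n/K) ≃ ℤ/p^nℤ`). [cite: Washington1997, §13.1] -/
def finiteDimensional_layer : Prop :=
  ∀ [PerfectField K] (n : ℕ),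
    FiniteDimensional K (κ.layer n)

/-- `[K_n : K] = p^n` (perfect `K`): `κ` is surjective, so `Γ_K/κ⁻¹(p^n ℤ_p) ≃ ℤ_p/p^n ℤ_p`.
Ref: Washington, *Introduction to Cyclotomic Fields*, §13.1 (`Gal(K_n/K) ≃ ℤ/p^nℤ`).
[cite: Washington1997, §13.1] -/
def finrank_layer : Prop :=
  ∀ [PerfectField K] (n : ℕ),
    Module.finrank K (κ.layer n) = p ^ n

/-- Each layer `K_n/K` is Galois (cyclic of order `p^n`) for perfect `K`
(`κ⁻¹(p^n ℤ_p)` is normal in `Γ_K`).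
Ref: Washington, *Introduction to Cyclotomic Fields*, §13.1 (`Gal(K_n/K) ≃ ℤ/p^nℤ`).
[cite: Washington1997, §13.1] -/
def isGalois_layer : Prop :=
  ∀ [PerfectField K] (n : ℕ),
    IsGalois K (κ.layer n)

/-- `K_∞ = ⋃ₙ K_n`: the top field is the supremum of the layers (`ker κ = ⋂ₙ κ⁻¹(p^n ℤ_p)` and
the Krull–Galois correspondence for closed subgroups).
Ref: Washington, *Introduction to Cyclotomic Fields*, §13.1 (`K_∞ = ⋃ K_n`).
[cite: Washington1997, §13.1] -/
def iSup_layer_eq_top : Prop :=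
  ⨆ n, κ.layer n = κ.top

/-- A unit twist does not change the kernel (hence not `K_∞`): `u·x = 0 ↔ x = 0` in the domain
`ℤ_p`.  Ref: Washington, *Introduction to Cyclotomic Fields*, §13.1. [folklore] -/
lemma kerSubgroup_unitTwist (u : ℤ_[p]ˣ) :
    (κ.unitTwist u).kerSubgroup = κ.kerSubgroup := by
  ext σ
  rw [mem_kerSubgroup, mem_kerSubgroup, unitTwist_apply, ← ofAdd_zero, Equiv.apply_eq_iff_eq,
    Units.mul_right_eq_zero, Equiv.apply_eq_iff_eq_symm_apply]
  rfl

/-- A unit twist does not change the layer subgroups (hence not the `K_n`):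
`p^n ∣ u·x ↔ p^n ∣ x` for a unit `u`.
Ref: Washington, *Introduction to Cyclotomic Fields*, §13.1. [folklore] -/
lemma layerSubgroup_unitTwist (u : ℤ_[p]ˣ) (n : ℕ) :
    (κ.unitTwist u).layerSubgroup n = κ.layerSubgroup n := by
  ext σ
  rw [mem_layerSubgroup, mem_layerSubgroup, unitTwist_apply, toAdd_ofAdd, Units.dvd_mul_left]

/-- Hence a unit twist does not change the top field `K_∞`. [folklore] -/
lemma top_unitTwist (u : ℤ_[p]ˣ) : (κ.unitTwist u).top = κ.top := by
  rw [top, top, kerSubgroup_unitTwist]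

/-- Hence a unit twist does not change the layers `K_n`. [folklore] -/
lemma layer_unitTwist (u : ℤ_[p]ˣ) (n : ℕ) : (κ.unitTwist u).layer n = κ.layer n := by
  rw [layer, layer, layerSubgroup_unitTwist]

variable (K p) in
/-- **Existence of the cyclotomic `ℤ_p`-extension.**  If `char K = 0` and the `p`-adic cyclotomic
character of `K` has infinite image (e.g. `K` a number field), then `χ_p(Γ_K)` is an open subgroup
of `ℤ_pˣ`, `χ_p(Γ_K)/μ ≃ ℤ_p`, and `K_∞^{cyc} ⊆ K(μ_{p^∞})` is a `ℤ_p`-extension.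
Ref: Washington, *Introduction to Cyclotomic Fields*, §13.1 (p. 264); Iwasawa (1959). [cite: Iwasawa1959] -/
def exists_isCyclotomic : Prop :=
  ∀ [CharZero K] (h : (Set.range (GaloisRepresentations.GaloisRep.cyclotomicCharacter K p)).Infinite),
    ∃ κ : ZpExtension K p, κ.IsCyclotomic

variable {κ} in
/-- **Uniqueness up to units.**  Two `ℤ_p`-extensions with the same kernel — in particular two
cyclotomic ones — differ by a unit twist: the induced automorphism of `ℤ_p` preserves each
`p^n ℤ_p`, hence is continuous and `ℤ_p`-linear.  (A corollary of
`exists_eq_unitTwist_of_kerSubgroup_eq`, see `IsCyclotomic.exists_eq_unitTwist_of`.)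
Ref: Washington, *Introduction to Cyclotomic Fields*, §13.1 (the cyclotomic `ℤ_p`-extension is
*the* unique `ℤ_p`-extension of `K` inside `K(μ_{p^∞})`; `Aut_cont(ℤ_p) = ℤ_pˣ`).
[cite: Washington1997, §13.1] -/
def IsCyclotomic.exists_eq_unitTwist : Prop :=
  ∀ {κ' : ZpExtension K p} (h : κ.IsCyclotomic) (h' : κ'.IsCyclotomic),
    ∃ u : ℤ_[p]ˣ, κ' = κ.unitTwist u

/-- More generally, `ℤ_p`-extensions with equal kernels differ by a unit twist: both factor
through `Γ_K/ker ≃ ℤ_p`, and a continuous automorphism of `ℤ_p` is multiplication by a unit.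
Ref: Washington, *Introduction to Cyclotomic Fields*, §13.1. [cite: Washington1997, §13.1] -/
def exists_eq_unitTwist_of_kerSubgroup_eq : Prop :=
  ∀ {κ' : ZpExtension K p} (h : κ'.kerSubgroup = κ.kerSubgroup),
    ∃ u : ℤ_[p]ˣ, κ' = κ.unitTwist u

variable {κ} in
/-- The cyclotomic uniqueness statement follows from the kernel-uniqueness statement, since two
cyclotomic `ℤ_p`-extensions have the same kernel `χ_p⁻¹(μ(ℤ_p))` by definition. [folklore] -/
theorem IsCyclotomic.exists_eq_unitTwist_of (hker : κ.exists_eq_unitTwist_of_kerSubgroup_eq) :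
    IsCyclotomic.exists_eq_unitTwist (κ := κ) :=
  fun h h' => hker (h'.trans h.symm)

/-- **Existence of the anticyclotomic `ℤ_p`-extension** of an imaginary quadratic field `K`:
the `-1`-eigenspace of complex conjugation on `Gal(K̃_∞/K) ≃ ℤ_p²` (compositum of all
`ℤ_p`-extensions; Leopoldt holds for `K`) cuts out a `ℤ_p`-extension, Galois and pro-dihedral
over `ℚ`.
Ref: Greenberg, *Iwasawa theory for elliptic curves*, LNM 1716 (1999), §1 (the anticyclotomic
`ℤ_p`-extension of an imaginary quadratic field); Washington, Thm. 13.4 (`ℤ_p`-rank `r₂ + 1 = 2`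
for imaginary quadratic `K`, Leopoldt holding for abelian `K/ℚ`).
[cite: GreenbergLNM1716, §1] [cite: Washington1997, Thm. 13.4] -/
def exists_isAnticyclotomic : Prop :=
  ∀ [NumberField K] (hK : Module.finrank ℚ K = 2) (himag : ∀ w : NumberField.InfinitePlace K, w.IsComplex),
    ∃ κ : ZpExtension K p, κ.IsAnticyclotomic

/-! ### Discharges (D-0014: the named facts above stay `def`s; users' `(h : X)` are fed `X_holds`) -/

/-- The index of `pⁿ ℤ_p` in `ℤ_p` is `pⁿ`: `pⁿ ℤ_p = ker (ℤ_p → ℤ/pⁿℤ)` (`PadicInt.ker_toZModPow`) and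
`ℤ_p → ℤ/pⁿℤ` is onto.  Ref: Washington, *Introduction to Cyclotomic Fields*, §13.1 (the closed
subgroups of `ℤ_p` are `0` and the `pⁿ ℤ_p`, of index `pⁿ`). [folklore] -/
lemma index_toSubgroup_span_pow (n : ℕ) :
    (AddSubgroup.toSubgroup (Ideal.span {(p : ℤ_[p]) ^ n}).toAddSubgroup).index = p ^ n := by
  rw [AddSubgroup.index_toSubgroup]
  have hker : (Ideal.span {(p : ℤ_[p]) ^ n}).toAddSubgroup =
      (PadicInt.toZModPow n : ℤ_[p] →+* ZMod (p ^ n)).toAddMonoidHom.ker := by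
    rw [← PadicInt.ker_toZModPow]
    rfl
  rw [hker, AddSubgroup.index_ker, AddMonoidHom.range_eq_top_of_surjective _
    (ZMod.ringHom_surjective (PadicInt.toZModPow n)), AddSubgroup.card_top, Nat.card_zmod]

/-- `[Γ_K : κ⁻¹(pⁿ ℤ_p)] = pⁿ`: `κ` is surjective, so the index is that of `pⁿ ℤ_p` in `ℤ_p`
(`Subgroup.index_comap_of_surjective`).
Ref: Washington, *Introduction to Cyclotomic Fields*, §13.1 (`Gal(K_∞/K)/pⁿ ≃ ℤ/pⁿℤ`). [folklore] -/
lemma index_layerSubgroup (n : ℕ) : (κ.layerSubgroup n).index = p ^ n := by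
  rw [layerSubgroup, Subgroup.index_comap_of_surjective _ κ.surjective, index_toSubgroup_span_pow]

/-- The subgroup `κ⁻¹(pⁿ ℤ_p)`, transported to `K̄ ≃ₐ[K] K̄` along the identity `toAlgEquiv`, is
closed (it is open, `isOpen_layerSubgroup`, and open subgroups are closed). [folklore] -/
lemma isClosed_map_layerSubgroup (n : ℕ) :
    IsClosed (((κ.layerSubgroup n).map (absoluteGaloisGroup.toAlgEquiv K).toMonoidHom :
      Subgroup (AlgebraicClosure K ≃ₐ[K] AlgebraicClosure K)) :
        Set (AlgebraicClosure K ≃ₐ[K] AlgebraicClosure K)) := by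
  refine Subgroup.isClosed_of_isOpen _ ?_
  have hHeq : (((κ.layerSubgroup n).map (absoluteGaloisGroup.toAlgEquiv K).toMonoidHom :
      Subgroup (AlgebraicClosure K ≃ₐ[K] AlgebraicClosure K)) :
        Set (AlgebraicClosure K ≃ₐ[K] AlgebraicClosure K)) =
      (absoluteGaloisGroup.toAlgEquiv K).symm ⁻¹' (κ.layerSubgroup n) := by
    rw [Subgroup.coe_map]
    exact (absoluteGaloisGroup.toAlgEquiv K).toEquiv.image_eq_preimage_symm _
  have hcont : Continuous (absoluteGaloisGroup.toAlgEquiv K).symm := continuous_id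
  rw [hHeq]
  exact (κ.isOpen_layerSubgroup n).preimage hcont

/-- Krull–Galois: the fixing subgroup of the layer `K_n = K̄^{H}`, `H = κ⁻¹(pⁿ ℤ_p)`, is `H` itself
(perfect `K`, so that `K̄/K` is Galois; `H` is closed, `InfiniteGalois.fixingSubgroup_fixedField`).
Ref: Washington, *Introduction to Cyclotomic Fields*, §13.1. [folklore] -/
lemma fixingSubgroup_layer [PerfectField K] (n : ℕ) :
    (κ.layer n).fixingSubgroup =
      (κ.layerSubgroup n).map (absoluteGaloisGroup.toAlgEquiv K).toMonoidHom :=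
  InfiniteGalois.fixingSubgroup_fixedField (k := K) (K := AlgebraicClosure K)
    ⟨_, κ.isClosed_map_layerSubgroup n⟩

/-- **Discharge of `finrank_layer`**: `[K_n : K] = pⁿ` for perfect `K`.
Proof (the printed architecture, Washington §13.1: `Gal(K_n/K) ≃ Gal(K_∞/K)/pⁿ ≃ ℤ/pⁿℤ`):
`[K_n : K] = [Gal(K̄/K) : Fix(K_n)]` (`IntermediateField.finrank_eq_fixingSubgroup_index`, `K̄/K`
Galois as `K` is perfect) `= [Γ_K : κ⁻¹(pⁿ ℤ_p)]` (`fixingSubgroup_layer`, the subgroup being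
open hence closed) `= [ℤ_p : pⁿ ℤ_p] = pⁿ` (`index_layerSubgroup`, `κ` surjective).
Ref: Washington, *Introduction to Cyclotomic Fields* (2nd ed. 1997), Ch. 13, §13.1, p. 264
(`Gal(K_n/K) ≃ ℤ/pⁿℤ`). [cite: Washington1997, §13.1] -/
theorem finrank_layer_holds : κ.finrank_layer := by
  intro _ n
  rw [IntermediateField.finrank_eq_fixingSubgroup_index, fixingSubgroup_layer,
    Subgroup.index_map_of_bijective (absoluteGaloisGroup.toAlgEquiv K).bijective,
    index_layerSubgroup]

/-- **Discharge of `finiteDimensional_layer`**: `K_n/K` is finite (of degree `pⁿ > 0`,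
`finrank_layer_holds`, `Module.finite_of_finrank_pos`).
Ref: Washington, *Introduction to Cyclotomic Fields*, §13.1. [cite: Washington1997, §13.1] -/
theorem finiteDimensional_layer_holds : κ.finiteDimensional_layer := by
  intro _ n
  refine Module.finite_of_finrank_pos ?_
  rw [κ.finrank_layer_holds n]
  exact pow_pos (Fact.out : p.Prime).pos n

/-- **Discharge of `isGalois_layer`**: `K_n/K` is Galois for perfect `K`, since its fixing subgroup
`κ⁻¹(pⁿ ℤ_p)` (`fixingSubgroup_layer`) is normal (`InfiniteGalois.normal_iff_isGalois`).
Ref: Washington, *Introduction to Cyclotomic Fields*, §13.1 (`Gal(K_n/K) ≃ ℤ/pⁿℤ`).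
[cite: Washington1997, §13.1] -/
theorem isGalois_layer_holds : κ.isGalois_layer := by
  intro _ n
  rw [← InfiniteGalois.normal_iff_isGalois, fixingSubgroup_layer]
  exact (κ.layerSubgroup_normal n).map _ (absoluteGaloisGroup.toAlgEquiv K).surjective

end ZpExtension

end Literature.NumberTheory.EllipticCurves
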